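import Summits.ValiantsHypothesis.ValiantsHypothesis.Theorems.GrenetZeonDualUnipotentThreeHalvesLongMassValueSpaceFree
import Summits.ValiantsHypothesis.ValiantsHypothesis.Theorems.GrenetZeonDualUnipotentThreeHalvesLongMassValueSpace
import Summits.ValiantsHypothesis.ValiantsHypothesis.Theorems.GrenetZeonDualUnipotentThreeHalvesLongMassRankOneGeneral

/-!
# `GrenetZeon.DualUnipotentThreeHalves` (stmt-ValiantsHypothesis-24318), line `slow_core`, stub (c) `SlowCore.LongMassSlowLawInv`:
# THE RANK-ONE ROW, INTRINSIC FORM — (c) holds (`c = 3`) whenever the VALUE SPACE is spanned by rank-one matrices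

✓ `LongMassRankOne.relCert_of_rankOne_linearPart` (★★★, val-…, `…LongMassRankOneGeneral`) prices every affine nilpotent pencil whose linear
COEFFICIENT MATRICES `[x_e]N = u_e w_eᵀ` all have rank `≤ 1` at `3·⌊√n⌋·b`.  That hypothesis depends on the PARAMETRISATION (a change of
coordinates mixes the coefficient matrices).  With the value-space invariance of this hand (✓ `relCert_of_valueSpace`, ✓
`pow_eq_zero_of_valueSpace_le`) the row becomes INTRINSIC:

★★★ `relCert_of_valueSpace_spanned_by_rankOne` — a LINEAR nilpotent pencil `N` over the `n²` coordinates whose value space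
`W̄(N) = {linMat N v}` is SPANNED by (at most `n²`) rank-`≤ 1` matrices `u_e w_eᵀ ∈ W̄(N)` has `RelCert n b N (3·(⌊√n⌋·b))` — whatever its own
coefficient matrices are.  (Re-parametrise: the linear pencil `N₁ = Σ_e x_e · u_e w_eᵀ` has the same value space, is nilpotent by
`pow_eq_zero_of_valueSpace_le`, is priced by the rank-one row, and the price transfers by `relCert_of_valueSpace`.)

ENEMY-SPEC READING (crit-7 V34 §2, sharpened): a (c)-violator's value space is NOT spanned by its rank-one elements (an intrinsic condition;
the earlier reading «has a coefficient matrix of rank ≥ 2» was basis-dependent).  Honest framing.  A support row (`--supports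
stmt-ValiantsHypothesis-24318`), NOT progress on (c) beyond re-pricing a known class intrinsically: (c) `SlowCore.LongMassSlowLawInv`, S3, the crux
24318, 8062 and `VP ≠ VNP` remain OPEN / NOT proved.  No sorry, no definitions, no named facts.
-/

-- single-conjunct layout: Sub = Summit, duplicated namespace component intended (the name is mandated)
set_option linter.dupNamespace false
set_option autoImplicit false

noncomputable section

namespace Summit.ValiantsHypothesis.ValiantsHypothesis.Theorems.GrenetZeon.LongMassHomogenise

open MvPolynomial Matrix
open scoped BigOperators
open Summit.ValiantsHypothesis.ValiantsHypothesis.Cruxes.TwoDimCoefficients.DimTwoCases (AffMat IsAffine)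
open Summit.ValiantsHypothesis.ValiantsHypothesis.Theorems.GrenetZeon.SlowCore
open Summit.ValiantsHypothesis.ValiantsHypothesis.Theorems.GrenetZeon.ResolventFlag (linMat)
open Summit.ValiantsHypothesis.ValiantsHypothesis.Theorems.GrenetZeon.LedgerIndex (exists_linearMap_linMat)
open Summit.ValiantsHypothesis.ValiantsHypothesis.Theorems.GrenetZeon.LongMassRankOne (relCert_of_rankOne_linearPart)

variable {n b : ℕ}

/-- The linear coefficient matrices of the pencil `Σ_e x_e · M_e` are the `M_e`. -/
theorem coeff_single_of_coordPencil (M : Fin n × Fin n → Matrix (Fin b) (Fin b) ℂ) (N₁ : AffMat n b)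
    (hN₁ : ∀ i j, N₁ i j = ∑ e, C (M e i j) * X e) (e : Fin n × Fin n) (i j : Fin b) :
    coeff (Finsupp.single e 1) (N₁ i j) = M e i j := by
  classical
  rw [hN₁ i j, coeff_sum]
  simp only [coeff_C_mul, coeff_X, mul_ite, mul_one, mul_zero]
  rw [Finset.sum_eq_single e]
  · simp
  · intro e' _ hne
    rw [if_neg]
    intro h
    exact hne ((Finsupp.single_left_inj one_ne_zero).mp h)
  · intro h; exact absurd (Finset.mem_univ e) h

/-- VALUE FORMULA of the pencil `Σ_e x_e · M_e`: `linMat N₁ v = Σ_e v_e • M_e`. -/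
theorem linMat_of_coordPencil (M : Fin n × Fin n → Matrix (Fin b) (Fin b) ℂ) (N₁ : AffMat n b)
    (hN₁ : ∀ i j, N₁ i j = ∑ e, C (M e i j) * X e) (v : Fin n × Fin n → ℂ) :
    linMat N₁ v = ∑ e, v e • M e := by
  ext i j
  rw [linMat, Matrix.of_apply, linEntry, Matrix.sum_apply]
  refine Finset.sum_congr rfl fun e _ => ?_
  rw [coeff_single_of_coordPencil M N₁ hN₁, Matrix.smul_apply, smul_eq_mul]

/-- ★★★ **THE RANK-ONE ROW, INTRINSIC FORM.**  A linear nilpotent pencil whose value space is spanned by rank-`≤ 1` matrices `u_e w_eᵀ` lying in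
it has a whole-pencil certificate of price `≤ 3·⌊√n⌋·b` — (c) with `c = 3` on this locus, independently of the parametrisation. -/
theorem relCert_of_valueSpace_spanned_by_rankOne (N : AffMat n b) (hN : IsAffine N) (h0 : ∀ i j, coeff 0 (N i j) = 0)
    {H : ℕ} (hnil : N ^ H = 0) (u w : Fin n × Fin n → Fin b → ℂ)
    (hmem : ∀ e, ∃ v, vecMulVec (u e) (w e) = linMat N v)
    (hspan : ∀ v, ∃ c : Fin n × Fin n → ℂ, linMat N v = ∑ e, c e • vecMulVec (u e) (w e)) :
    RelCert n b N (3 * (Nat.sqrt n * b)) := by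
  classical
  -- the re-parametrised pencil `N₁ = Σ_e x_e · u_e w_eᵀ`
  let M : Fin n × Fin n → Matrix (Fin b) (Fin b) ℂ := fun e => vecMulVec (u e) (w e)
  let N₁ : AffMat n b := Matrix.of fun i j => ∑ e, C (M e i j) * X e
  have hN₁ : ∀ i j, N₁ i j = ∑ e, C (M e i j) * X e := fun i j => rfl
  have haff : IsAffine N₁ := by
    intro i j
    rw [hN₁ i j]
    refine (totalDegree_finsetSum _ _).trans (Finset.sup_le fun e _ => ?_)
    exact (totalDegree_mul _ _).trans (by rw [totalDegree_C, totalDegree_X, zero_add])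
  have h0₁ : ∀ i j, coeff 0 (N₁ i j) = 0 := by
    intro i j
    rw [hN₁ i j, coeff_sum]
    simp [coeff_C_mul]
  have hval : ∀ v, linMat N₁ v = ∑ e, v e • M e := linMat_of_coordPencil M N₁ hN₁
  -- the two value spaces coincide
  obtain ⟨T, hT⟩ := exists_linearMap_linMat N
  have hle : ∀ v, ∃ v₁, linMat N v = linMat N₁ v₁ := by
    intro v
    obtain ⟨c, hc⟩ := hspan v
    exact ⟨c, by rw [hval, hc]⟩
  have hge : ∀ v₁, ∃ v, linMat N₁ v₁ = linMat N v := by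
    intro v₁
    choose pre hpre using hmem
    refine ⟨∑ e, v₁ e • pre e, ?_⟩
    rw [hval, ← hT, map_sum]
    refine Finset.sum_congr rfl fun e _ => ?_
    rw [map_smul, hT, ← hpre e]
  -- nilpotency of `N₁` is inherited from `N`
  have hNb : N ^ b = 0 := pow_card_eq_zero_of_pow_eq_zero N hnil
  have hnil₁ : N₁ ^ b = 0 := pow_eq_zero_of_valueSpace_le N N₁ hN haff h0 h0₁ hge hNb
  -- the rank-one row prices `N₁`; the price transfers along the value space
  have hcoef : ∀ e i j, coeff (Finsupp.single e 1) (N₁ i j) = u e i * w e j := by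
    intro e i j
    rw [coeff_single_of_coordPencil M N₁ hN₁]
    rfl
  exact relCert_of_valueSpace N N₁ hN haff h0 h0₁ hle hge (relCert_of_rankOne_linearPart N₁ haff hnil₁ u w hcoef)

end Summit.ValiantsHypothesis.ValiantsHypothesis.Theorems.GrenetZeon.LongMassHomogenise

end
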